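import Summits.AtomisticToContinuum.HydrodynamicLimit.Theorems.InformationPercolationEngineChaosClosesEulerReductionWeak
import Summits.AtomisticToContinuum.HydrodynamicLimit.Theorems.InformationPercolationEngineChaosClosesEulerReductionTransport
import Summits.AtomisticToContinuum.HydrodynamicLimit.Theorems.InformationPercolationEngineChaosClosesEulerReductionStrip
import HarnessLib

/-!
# Kinetic reduction (crux `ChaosClosesEuler`, stmt-AtomisticToContinuum-15141, line `Sketch`,
# stub `stub_kineticReduction`) — helper: the momentum residual along one orbit, decomposed

WHAT. The momentum residual (H2) of the BF18 shell for the cone field `V = (ρ_r, m_r, e_r)` of ONE good orbit,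
written with the SHIFTED classical velocity `ũ(· + e)`:
`R^e(τ) = ∫⟪ũ(τ+e), m_r(τ)⟫ − ∫⟪ũ(e), m_r(0)⟫ − ∫_{[0,τ]}∫ (⟪∂ₜũ(s+e), m_r⟫ + ∑ᵢⱼ ∂ⱼũᵢ(s+e)(mᵢmⱼ/ρ_r + δᵢⱼ p_V))`,
`p_V = ρ_rθ_r χ(ρ_r)`. By the exact momentum identity (helper `ReductionWeak`) and the transport algebra (helper
`ReductionTransport`), for every `τ ∈ [0, b]`:

`R^e(τ) = W^e(τ) + P^e(τ) + (N+1)⁻¹ J(0, τ]`,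

`W^e(τ) = ∫_{[0,τ]}∫ ∑ Aᵢⱼ Pᵢⱼ` (traceless part of `∇ũ(s+e)` against the central tensor),
`P^e(τ) = ∫_{[0,τ]}∫ (tr ∇ũ(s+e)) (ρ_rθ_r − p_V)`, `J` the collision functional of the momentum identity
(`residual_decomposition`). All integrands are kinetically dominated (helper `ReductionTransport`), so the window
pieces of `W^e`, `P^e` over `(τ', τ]` are `O((τ − τ') ke)` with `r`-independent constants (`residual_moduli`).

No named fact is invoked.
-/

noncomputable section

namespace Summit.AtomisticToContinuum.HydrodynamicLimit.Theorems.ChaosClosesEulerReduction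

open scoped BigOperators Topology Classical MeasureTheory ENNReal InnerProductSpace
open Filter Set MeasureTheory Function
open Literature.MathematicalPhysics.KineticTheory
open Literature.Analysis.FluidPDE
open Literature.Analysis.FunctionSpaces
open Summit.AtomisticToContinuum.HydrodynamicLimit.Theorems.LocalSecondLawNegative
open Summit.AtomisticToContinuum.HydrodynamicLimit.Theorems.LocalSecondLawLedger
open Summit.AtomisticToContinuum.HydrodynamicLimit.Theorems.LocalSecondLawLedger.L (Mmom Mmom_symm)

variable {N : ℕ}

/-! ## §1 Measurability recipes for the four integrands -/

/-- **The four integrands of the momentum residual are a.e. measurable** whenever their factors are: the flux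
integrand of (H2), the `k`-th transport integrand of the momentum identity, the traceless-stress integrand and the
pressure integrand. [folklore] -/
theorem aemeasurable_residual_recipes {α : Type*} [MeasurableSpace α] {ν : Measure α} {Ut m : α → V3}
    {D Mm : Fin 3 → Fin 3 → α → ℝ} {ρ θc χρ : α → ℝ}
    (hUt : AEMeasurable Ut ν) (hm : AEMeasurable m ν) (hD : ∀ i j, AEMeasurable (D i j) ν)
    (hMm : ∀ i j, AEMeasurable (Mm i j) ν) (hρ : AEMeasurable ρ ν) (hθ : AEMeasurable θc ν) (hχ : AEMeasurable χρ ν) :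
    AEMeasurable (fun a => ⟪Ut a, m a⟫_ℝ +
      ∑ i : Fin 3, ∑ j : Fin 3, D i j a * (m a i * m a j / ρ a + if i = j then ρ a * θc a * χρ a else 0)) ν ∧
    (∀ k : Fin 3, AEMeasurable (fun a => Ut a k * m a k + ∑ j : Fin 3, Mm j k a * D k j a) ν) ∧
    AEMeasurable (fun a => ∑ i : Fin 3, ∑ j : Fin 3, (D i j a - if i = j then (∑ k : Fin 3, D k k a) / 3 else 0) *
      (Mm i j a - m a i * m a j / ρ a)) ν ∧
    AEMeasurable (fun a => (∑ k : Fin 3, D k k a) * (ρ a * θc a - ρ a * θc a * χρ a)) ν := by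
  have hmk : ∀ k, AEMeasurable (fun a => m a k) ν := fun k =>
    (EuclideanSpace.proj k : V3 →L[ℝ] ℝ).continuous.measurable.comp_aemeasurable hm
  have hUk : ∀ k, AEMeasurable (fun a => Ut a k) ν := fun k =>
    (EuclideanSpace.proj k : V3 →L[ℝ] ℝ).continuous.measurable.comp_aemeasurable hUt
  refine ⟨?_, fun k => ?_, ?_, ?_⟩
  · refine (hUt.inner hm).add (Finset.aemeasurable_fun_sum _ fun i _ => Finset.aemeasurable_fun_sum _ fun j _ => ?_)
    refine (hD i j).mul ((((hmk i).mul (hmk j)).div hρ).add ?_)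
    by_cases h : i = j
    · simp only [h, if_true]; exact (hρ.mul hθ).mul hχ
    · simp only [h, if_false]; exact aemeasurable_const
  · exact ((hUk k).mul (hmk k)).add (Finset.aemeasurable_fun_sum _ fun j _ => (hMm j k).mul (hD k j))
  · refine Finset.aemeasurable_fun_sum _ fun i _ => Finset.aemeasurable_fun_sum _ fun j _ => ?_
    refine AEMeasurable.mul ?_ ((hMm i j).sub (((hmk i).mul (hmk j)).div hρ))
    by_cases h : i = j
    · simp only [h, if_true]; exact (hD j j).sub ((Finset.aemeasurable_fun_sum _ fun k _ => hD k k).div_const _)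
    · simp only [h, if_false]; exact (hD i j).sub aemeasurable_const
  · exact (Finset.aemeasurable_fun_sum _ fun k _ => hD k k).mul ((hρ.mul hθ).sub ((hρ.mul hθ).mul hχ))

/-! ## §2 The registered sub-goal: pointwise split of the transport integrand -/

/-- **Registered sub-goal `stub_reductionResidual` (helper of `stub_kineticReduction`): the transport integrand of
the momentum identity minus the flux integrand of the shell is the traceless-stress term plus the pressure term,
pointwise** (the transport algebra with `D = ∇ũ`, `p = p_V`; the `⟪∂ₜũ, m_r⟫` terms cancel). [folklore] -/
theorem stub_reductionResidual : ∀ {N : ℕ} {r : ℝ}, 0 < r → ∀ (w : Config (N + 1) (Fin 3) T3) (x : T3) (D : Fin 3 → Fin 3 → ℝ) (a p : ℝ), (a + ∑ i : Fin 3, ∑ j : Fin 3, D i j * Mmom r w x i j) - (a + ∑ i : Fin 3, ∑ j : Fin 3, D i j * (momC r w x i * momC r w x j / rhoC r w x + if i = j then p else 0)) = (∑ i : Fin 3, ∑ j : Fin 3, (D i j - if i = j then (∑ k : Fin 3, D k k) / 3 else 0) * (Mmom r w x i j - momC r w x i * momC r w x j / rhoC r w x)) + (∑ k : Fin 3, D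 k k) * (rhoC r w x * thetaC r w x - p) := by
  intro N r hr w x D a p
  rw [transport_pointwise hr w x D p]; ring

/-! ## §3 Pointwise domination of the four integrands -/

section Pointwise

variable {r : ℝ} {Cu B : ℝ} {ut : V3} {D : Fin 3 → Fin 3 → ℝ} {χe : ℝ → ℝ}

/-- `|⟪∂ₜũ, m_r⟫| ≤ Cu (ρ_r/2 + e_r)`. [folklore] -/
theorem abs_inner_ut_le (hr : 0 < r) (w : Phase N) (x : T3) (hCu : 0 ≤ Cu) (hut : ‖ut‖ ≤ Cu) :
    |⟪ut, momC r w x⟫_ℝ| ≤ 0 + Cu * kinC r w x + Cu / 2 * rhoC r w x := by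
  have h1 : |⟪ut, momC r w x⟫_ℝ| ≤ ‖ut‖ * ‖momC r w x‖ := abs_real_inner_le_norm _ _
  have h2 := norm_momC_le_half hr w x
  have h3 : ‖ut‖ * ‖momC r w x‖ ≤ Cu * (rhoC r w x / 2 + kinC r w x) :=
    mul_le_mul hut h2 (norm_nonneg _) hCu
  linarith

/-- `|∑ Dᵢⱼ Mᵢⱼ| ≤ 18 Cu e_r`. [folklore] -/
theorem abs_sum_D_Mmom_le (hr : 0 < r) (w : Phase N) (x : T3) (hCu : 0 ≤ Cu) (hD : ∀ i j, |D i j| ≤ Cu) :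
    |∑ i : Fin 3, ∑ j : Fin 3, D i j * Mmom r w x i j| ≤ 9 * (Cu * (2 * kinC r w x)) :=
  abs_sum_sum_le fun i j => by
    rw [abs_mul]; exact mul_le_mul (hD i j) (abs_Mmom_le hr w x i j) (abs_nonneg _) hCu

/-- `|∑ Dᵢⱼ (mᵢmⱼ/ρ_r + δᵢⱼ p_V)| ≤ Cu (6 + 2B) e_r`. [folklore] -/
theorem abs_sum_D_flux_le (hr : 0 < r) (w : Phase N) (x : T3) (hCu : 0 ≤ Cu) (hB0 : 0 ≤ B) (hD : ∀ i j, |D i j| ≤ Cu)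
    (hB : ∀ a, 0 < a → |χe a| ≤ B) :
    |∑ i : Fin 3, ∑ j : Fin 3, D i j * (momC r w x i * momC r w x j / rhoC r w x +
      if i = j then rhoC r w x * thetaC r w x * χe (rhoC r w x) else 0)| ≤ Cu * (6 + 2 * B) * kinC r w x := by
  have hsplit : ∑ i : Fin 3, ∑ j : Fin 3, D i j * (momC r w x i * momC r w x j / rhoC r w x +
      if i = j then rhoC r w x * thetaC r w x * χe (rhoC r w x) else 0) =
      (∑ i : Fin 3, ∑ j : Fin 3, D i j * (momC r w x i * momC r w x j / rhoC r w x)) +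
      (∑ k : Fin 3, D k k) * (rhoC r w x * thetaC r w x * χe (rhoC r w x)) := by
    have h2 : ∑ i : Fin 3, ∑ j : Fin 3, D i j * (if i = j then rhoC r w x * thetaC r w x * χe (rhoC r w x) else 0) =
        (∑ k : Fin 3, D k k) * (rhoC r w x * thetaC r w x * χe (rhoC r w x)) := by
      rw [Finset.sum_mul]
      refine Finset.sum_congr rfl fun i _ => ?_
      rw [Finset.sum_eq_single i (fun j _ hji => by rw [if_neg (Ne.symm hji), mul_zero])
        (fun h => absurd (Finset.mem_univ i) h), if_pos rfl]
    rw [← h2, ← Finset.sum_add_distrib]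
    refine Finset.sum_congr rfl fun i _ => ?_
    rw [← Finset.sum_add_distrib]
    refine Finset.sum_congr rfl fun j _ => by ring
  rw [hsplit]
  have hA : |∑ i : Fin 3, ∑ j : Fin 3, D i j * (momC r w x i * momC r w x j / rhoC r w x)| ≤ Cu * (6 * kinC r w x) :=
    (abs_sum_sum_mul_le hD).trans (mul_le_mul_of_nonneg_left (sum_abs_mm_div_le hr w x) hCu)
  have htr : |∑ k : Fin 3, D k k| ≤ 3 * Cu := by
    calc _ ≤ ∑ k : Fin 3, |D k k| := Finset.abs_sum_le_sum_abs _ _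
      _ ≤ ∑ _k : Fin 3, Cu := Finset.sum_le_sum fun k _ => hD k k
      _ = 3 * Cu := by simp [Finset.sum_const, Finset.card_univ]
  have hpv := abs_pV_le hr w x hB0 hB
  have hB' : |(∑ k : Fin 3, D k k) * (rhoC r w x * thetaC r w x * χe (rhoC r w x))| ≤ 3 * Cu * (2 / 3 * B * kinC r w x) := by
    rw [abs_mul]; exact mul_le_mul htr hpv (abs_nonneg _) (by positivity)
  calc _ ≤ |∑ i : Fin 3, ∑ j : Fin 3, D i j * (momC r w x i * momC r w x j / rhoC r w x)| +
        |(∑ k : Fin 3, D k k) * (rhoC r w x * thetaC r w x * χe (rhoC r w x))| := abs_add_le _ _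
    _ ≤ Cu * (6 * kinC r w x) + 3 * Cu * (2 / 3 * B * kinC r w x) := add_le_add hA hB'
    _ = Cu * (6 + 2 * B) * kinC r w x := by ring

/-- `|∑ Aᵢⱼ Pᵢⱼ| ≤ 60 Cu e_r` (`A` the traceless part of `D`, `P` the central tensor). [folklore] -/
theorem abs_sum_A_Pm_le (hr : 0 < r) (w : Phase N) (x : T3) (hCu : 0 ≤ Cu) (hD : ∀ i j, |D i j| ≤ Cu) :
    |∑ i : Fin 3, ∑ j : Fin 3, (D i j - if i = j then (∑ k : Fin 3, D k k) / 3 else 0) *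
      (Mmom r w x i j - momC r w x i * momC r w x j / rhoC r w x)| ≤ 2 * Cu * (30 * kinC r w x) :=
  (abs_sum_sum_mul_le (abs_traceless_le hD)).trans
    (mul_le_mul_of_nonneg_left (sum_abs_Pm_le hr w x) (by positivity))

/-- `|(tr D)(ρ_rθ_r − p_V)| ≤ 2 Cu (1 + B) e_r`. [folklore] -/
theorem abs_tr_pressure_le (hr : 0 < r) (w : Phase N) (x : T3) (hCu : 0 ≤ Cu) (hB0 : 0 ≤ B)
    (hD : ∀ i j, |D i j| ≤ Cu) (hB : ∀ a, 0 < a → |χe a| ≤ B) :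
    |(∑ k : Fin 3, D k k) * (rhoC r w x * thetaC r w x - rhoC r w x * thetaC r w x * χe (rhoC r w x))|
      ≤ 2 * Cu * (1 + B) * kinC r w x := by
  have htr : |∑ k : Fin 3, D k k| ≤ 3 * Cu := by
    calc _ ≤ ∑ k : Fin 3, |D k k| := Finset.abs_sum_le_sum_abs _ _
      _ ≤ ∑ _k : Fin 3, Cu := Finset.sum_le_sum fun k _ => hD k k
      _ = 3 * Cu := by simp [Finset.sum_const, Finset.card_univ]
  have h1 : |rhoC r w x * thetaC r w x - rhoC r w x * thetaC r w x * χe (rhoC r w x)| ≤ 2 / 3 * (1 + B) * kinC r w x := by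
    have ha := psvK_rhoC_mul_thetaC_le hr w x
    have hb := psvK_rhoC_mul_thetaC_nonneg hr w x
    have hc := abs_pV_le hr w x hB0 hB
    calc _ ≤ |rhoC r w x * thetaC r w x| + |rhoC r w x * thetaC r w x * χe (rhoC r w x)| := abs_sub _ _
      _ ≤ 2 / 3 * kinC r w x + 2 / 3 * B * kinC r w x := add_le_add (by rw [abs_of_nonneg hb]; exact ha) hc
      _ = 2 / 3 * (1 + B) * kinC r w x := by ring
  rw [abs_mul]
  calc |∑ k : Fin 3, D k k| * _ ≤ 3 * Cu * (2 / 3 * (1 + B) * kinC r w x) := mul_le_mul htr h1 (abs_nonneg _) (by positivity)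
    _ = 2 * Cu * (1 + B) * kinC r w x := by ring

/-- The `k`-th transport integrand of the momentum identity: `|∂ₜũₖ mₖ + ∑ⱼ Mⱼₖ ∂ⱼũₖ| ≤ Cu(ρ_r/2 + e_r) + 6Cu e_r`.
[folklore] -/
theorem abs_transport_k_le (hr : 0 < r) (w : Phase N) (x : T3) (hCu : 0 ≤ Cu) (hut : ‖ut‖ ≤ Cu)
    (hD : ∀ i j, |D i j| ≤ Cu) (k : Fin 3) :
    |ut k * momC r w x k + ∑ j : Fin 3, Mmom r w x j k * D k j| ≤ 0 + (Cu + 6 * Cu) * kinC r w x + Cu / 2 * rhoC r w x := by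
  have h1 : |ut k * momC r w x k| ≤ Cu * (rhoC r w x / 2 + kinC r w x) := by
    rw [abs_mul]
    have ha : |ut k| ≤ Cu := le_trans (by simpa using PiLp.norm_apply_le (p := 2) ut k) hut
    have hb : |momC r w x k| ≤ ‖momC r w x‖ := by simpa using PiLp.norm_apply_le (p := 2) (momC r w x) k
    exact mul_le_mul ha (hb.trans (norm_momC_le_half hr w x)) (abs_nonneg _) hCu
  have h2 : |∑ j : Fin 3, Mmom r w x j k * D k j| ≤ 3 * (2 * kinC r w x * Cu) := by
    calc _ ≤ ∑ j : Fin 3, |Mmom r w x j k * D k j| := Finset.abs_sum_le_sum_abs _ _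
      _ ≤ ∑ _j : Fin 3, 2 * kinC r w x * Cu := Finset.sum_le_sum fun j _ => by
          rw [abs_mul]; exact mul_le_mul (abs_Mmom_le hr w x j k) (hD k j) (abs_nonneg _)
            (mul_nonneg (by norm_num) (kinC_nonneg hr w x))
      _ = 3 * (2 * kinC r w x * Cu) := by simp [Finset.sum_const, Finset.card_univ]
  calc _ ≤ |ut k * momC r w x k| + |∑ j : Fin 3, Mmom r w x j k * D k j| := abs_add_le _ _
    _ ≤ Cu * (rhoC r w x / 2 + kinC r w x) + 3 * (2 * kinC r w x * Cu) := add_le_add h1 h2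
    _ = 0 + (Cu + 6 * Cu) * kinC r w x + Cu / 2 * rhoC r w x := by ring

end Pointwise


/-! ## §4 The four integrands along one orbit: kinetic domination -/

/-- **The four integrands of the momentum residual along one good orbit are kinetically dominated.** With `Cu` a
bound of `‖∂ₜũ‖` and of all `|∂ⱼũᵢ|` on `[0, b + e] × 𝕋³`, `B` a bound of `|χ|` on `(0, ∞)` (`χ` continuous there), the
conclusions of `spaceTime_bounds` hold on the strip `[0, b]` for: the flux integrand of (H2) (constants
`0, Cu(7 + 2B), Cu/2`), each transport integrand of the momentum identity (`0, 7Cu, Cu/2`), the traceless-stress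
integrand (`0, 60Cu, 0`) and the pressure integrand (`0, 2Cu(1+B), 0`). [folklore] -/
theorem residual_integrands {σ : ℝ} (Φ : HardSphereFlow (Torus.geometry (Fin 3)) (hsDiameter σ N) (N + 1))
    {z : Phase N} (hz : z ∈ Φ.good) {r : ℝ} (hr : 0 < r) (hr2 : r < 1 / 2)
    {T : ℝ} {u : ℝ → T3 → V3} (hu : Torus.IsSmoothSpaceTimeOn (Ico 0 T) u) {e b : ℝ} (he : 0 ≤ e) (hb : 0 ≤ b)
    (hbe : b + e < T) {χe : ℝ → ℝ} (hχ : ContinuousOn χe (Ioi 0)) {B : ℝ} (hB0 : 0 ≤ B) (hB : ∀ a, 0 < a → |χe a| ≤ B)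
    {Cu : ℝ} (hCu : 0 ≤ Cu) (hut : ∀ s ∈ Icc 0 b, ∀ x, ‖Torus.timeDerivWithin (Ico 0 T) u (s + e) x‖ ≤ Cu)
    (hD : ∀ s ∈ Icc 0 b, ∀ x, ∀ i j : Fin 3, |Torus.partialDeriv j (fun y => u (s + e) y i) x| ≤ Cu) :
    let FG : ℝ → T3 → ℝ := fun s x => ⟪Torus.timeDerivWithin (Ico 0 T) u (s + e) x, momC r (Φ.flow s z) x⟫_ℝ +
      ∑ i : Fin 3, ∑ j : Fin 3, Torus.partialDeriv j (fun y => u (s + e) y i) x *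
        (momC r (Φ.flow s z) x i * momC r (Φ.flow s z) x j / rhoC r (Φ.flow s z) x +
          if i = j then rhoC r (Φ.flow s z) x * thetaC r (Φ.flow s z) x * χe (rhoC r (Φ.flow s z) x) else 0)
    let FT : Fin 3 → ℝ → T3 → ℝ := fun k s x => (Torus.timeDerivWithin (Ico 0 T) u (s + e) x) k * momC r (Φ.flow s z) x k +
      ∑ j : Fin 3, Mmom r (Φ.flow s z) x j k * Torus.partialDeriv j (fun y => u (s + e) y k) x
    let FW : ℝ → T3 → ℝ := fun s x => ∑ i : Fin 3, ∑ j : Fin 3, (Torus.partialDeriv j (fun y => u (s + e) y i) x -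
        if i = j then (∑ k : Fin 3, Torus.partialDeriv k (fun y => u (s + e) y k) x) / 3 else 0) *
      (Mmom r (Φ.flow s z) x i j - momC r (Φ.flow s z) x i * momC r (Φ.flow s z) x j / rhoC r (Φ.flow s z) x)
    let FP : ℝ → T3 → ℝ := fun s x => (∑ k : Fin 3, Torus.partialDeriv k (fun y => u (s + e) y k) x) *
      (rhoC r (Φ.flow s z) x * thetaC r (Φ.flow s z) x -
        rhoC r (Φ.flow s z) x * thetaC r (Φ.flow s z) x * χe (rhoC r (Φ.flow s z) x))
    ((∀ s ∈ Icc 0 b, Integrable (FG s) volume) ∧ (∀ s ∈ Icc 0 b, |∫ x, FG s x| ≤ 0 + Cu * (7 + 2 * B) * ke z + Cu / 2) ∧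
      IntegrableOn (fun s => ∫ x, FG s x) (Icc 0 b) volume ∧
      |∫ s in Icc 0 b, ∫ x, FG s x| ≤ (b - 0) * (0 + Cu * (7 + 2 * B) * ke z + Cu / 2)) ∧
    (∀ k : Fin 3, (∀ s ∈ Icc 0 b, Integrable (FT k s) volume) ∧ (∀ s ∈ Icc 0 b, |∫ x, FT k s x| ≤ 0 + (Cu + 6 * Cu) * ke z + Cu / 2) ∧
      IntegrableOn (fun s => ∫ x, FT k s x) (Icc 0 b) volume ∧
      |∫ s in Icc 0 b, ∫ x, FT k s x| ≤ (b - 0) * (0 + (Cu + 6 * Cu) * ke z + Cu / 2)) ∧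
    ((∀ s ∈ Icc 0 b, Integrable (FW s) volume) ∧ (∀ s ∈ Icc 0 b, |∫ x, FW s x| ≤ 0 + 2 * Cu * 30 * ke z + 0) ∧
      IntegrableOn (fun s => ∫ x, FW s x) (Icc 0 b) volume ∧
      |∫ s in Icc 0 b, ∫ x, FW s x| ≤ (b - 0) * (0 + 2 * Cu * 30 * ke z + 0)) ∧
    ((∀ s ∈ Icc 0 b, Integrable (FP s) volume) ∧ (∀ s ∈ Icc 0 b, |∫ x, FP s x| ≤ 0 + 2 * Cu * (1 + B) * ke z + 0) ∧
      IntegrableOn (fun s => ∫ x, FP s x) (Icc 0 b) volume ∧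
      |∫ s in Icc 0 b, ∫ x, FP s x| ≤ (b - 0) * (0 + 2 * Cu * (1 + B) * ke z + 0)) := by
  intro FG FT FW FP
  -- the factors
  obtain ⟨mρ, mm, mmk, mk, mM, mθ, mχ⟩ := orbit_factors Φ hz hr hχ
  obtain ⟨cu, cuk, cut', cD⟩ := velocity_factors hu he hbe
  -- strip measurability and sections, via the recipes
  have hstrip := aemeasurable_residual_recipes (ν := (volume.restrict (Icc 0 b)).prod volume)
    (classical_factor cut').1.aemeasurable mm.aemeasurable (fun i j => (classical_factor (cD i j)).1.aemeasurable)
    (fun i j => (mM i j).aemeasurable) mρ.aemeasurable mθ.aemeasurable mχ.aemeasurable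
  have hsec : ∀ s ∈ Icc 0 b, _ := fun s hs =>
    aemeasurable_residual_recipes (ν := (volume : Measure T3))
      ((classical_factor cut').2 s hs).measurable.aemeasurable (orbit_factor mm b |>.2 s).aemeasurable
      (fun i j => ((classical_factor (cD i j)).2 s hs).measurable.aemeasurable)
      (fun i j => (orbit_factor (mM i j) b |>.2 s).aemeasurable) (orbit_factor mρ b |>.2 s).aemeasurable
      (orbit_factor mθ b |>.2 s).aemeasurable (orbit_factor mχ b |>.2 s).aemeasurable
  refine ⟨?_, fun k => ?_, ?_, ?_⟩
  · refine spaceTime_bounds Φ hz hr hr2 hb (F := FG) hstrip.1.aestronglyMeasurable (fun s hs => (hsec s hs).1.aestronglyMeasurable)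
      (by positivity) (by positivity) fun s hs x => ?_
    have h1 := abs_inner_ut_le hr (Φ.flow s z) x hCu (hut s hs x)
    have h2 := abs_sum_D_flux_le hr (Φ.flow s z) x hCu hB0 (hD s hs x) hB
    calc |FG s x| ≤ |⟪Torus.timeDerivWithin (Ico 0 T) u (s + e) x, momC r (Φ.flow s z) x⟫_ℝ| + _ := abs_add_le _ _
      _ ≤ (0 + Cu * kinC r (Φ.flow s z) x + Cu / 2 * rhoC r (Φ.flow s z) x) + Cu * (6 + 2 * B) * kinC r (Φ.flow s z) x :=
          add_le_add h1 h2
      _ = 0 + Cu * (7 + 2 * B) * kinC r (Φ.flow s z) x + Cu / 2 * rhoC r (Φ.flow s z) x := by ring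
  · refine spaceTime_bounds Φ hz hr hr2 hb (F := FT k) (hstrip.2.1 k).aestronglyMeasurable (fun s hs => ((hsec s hs).2.1 k).aestronglyMeasurable)
      (by positivity) (by positivity) fun s hs x => ?_
    exact abs_transport_k_le hr (Φ.flow s z) x hCu (hut s hs x) (hD s hs x) k
  · refine spaceTime_bounds Φ hz hr hr2 hb (F := FW) hstrip.2.2.1.aestronglyMeasurable (fun s hs => (hsec s hs).2.2.1.aestronglyMeasurable)
      (by positivity) le_rfl fun s hs x => ?_
    have h := abs_sum_A_Pm_le hr (Φ.flow s z) x hCu (hD s hs x)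
    calc |FW s x| ≤ 2 * Cu * (30 * kinC r (Φ.flow s z) x) := h
      _ = 0 + 2 * Cu * 30 * kinC r (Φ.flow s z) x + 0 * rhoC r (Φ.flow s z) x := by ring
  · refine spaceTime_bounds Φ hz hr hr2 hb (F := FP) hstrip.2.2.2.aestronglyMeasurable (fun s hs => (hsec s hs).2.2.2.aestronglyMeasurable)
      (by positivity) le_rfl fun s hs x => ?_
    have h := abs_tr_pressure_le hr (Φ.flow s z) x hCu hB0 (hD s hs x) hB
    calc |FP s x| ≤ 2 * Cu * (1 + B) * kinC r (Φ.flow s z) x := h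
      _ = 0 + 2 * Cu * (1 + B) * kinC r (Φ.flow s z) x + 0 * rhoC r (Φ.flow s z) x := by ring


/-! ## §5 The decomposition of the residual -/

set_option maxHeartbeats 800000 in
/-- **The momentum residual, decomposed.** For `0 < e`, `0 ≤ b`, `b + e < T` and `τ ∈ [0, b]`: with the integrands
`FG, FW, FP` of `residual_integrands`,
`∫⟪ũ(τ+e), m_r(τ)⟫ − ∫⟪ũ(e), m_r(0)⟫ − ∫_{[0,τ]}∫ FG = ∫_{[0,τ]}∫ FW + ∫_{[0,τ]}∫ FP + (N+1)⁻¹ J(0,τ]`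
(the exact momentum identity plus the transport algebra; `J` the collision functional of the momentum identity).
[folklore] -/
theorem residual_decomposition {σ : ℝ} (hσ : 0 < σ) (hσ2 : σ < 2⁻¹)
    (Φ : HardSphereFlow (Torus.geometry (Fin 3)) (hsDiameter σ N) (N + 1))
    {z : Phase N} (hz : z ∈ Φ.good) {r : ℝ} (hr : 0 < r) (hr2 : r < 1 / 2)
    {T : ℝ} {u : ℝ → T3 → V3} (hu : Torus.IsSmoothSpaceTimeOn (Ico 0 T) u) {e b : ℝ} (he : 0 < e) (hb : 0 ≤ b)
    (hbe : b + e < T) {χe : ℝ → ℝ} (hχ : ContinuousOn χe (Ioi 0)) {B : ℝ} (hB0 : 0 ≤ B) (hB : ∀ a, 0 < a → |χe a| ≤ B)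
    {Cu : ℝ} (hCu : 0 ≤ Cu) (hut : ∀ s ∈ Icc 0 b, ∀ x, ‖Torus.timeDerivWithin (Ico 0 T) u (s + e) x‖ ≤ Cu)
    (hD : ∀ s ∈ Icc 0 b, ∀ x, ∀ i j : Fin 3, |Torus.partialDeriv j (fun y => u (s + e) y i) x| ≤ Cu)
    {τ : ℝ} (hτ : τ ∈ Icc 0 b) :
    (∫ x, ⟪u (τ + e) x, momC r (Φ.flow τ z) x⟫_ℝ) - (∫ x, ⟪u (0 + e) x, momC r (Φ.flow 0 z) x⟫_ℝ) -
      (∫ s in Icc 0 τ, ∫ x, (⟪Torus.timeDerivWithin (Ico 0 T) u (s + e) x, momC r (Φ.flow s z) x⟫_ℝ +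
        ∑ i : Fin 3, ∑ j : Fin 3, Torus.partialDeriv j (fun y => u (s + e) y i) x *
          (momC r (Φ.flow s z) x i * momC r (Φ.flow s z) x j / rhoC r (Φ.flow s z) x +
            if i = j then rhoC r (Φ.flow s z) x * thetaC r (Φ.flow s z) x * χe (rhoC r (Φ.flow s z) x) else 0))) =
    (∫ s in Icc 0 τ, ∫ x, ∑ i : Fin 3, ∑ j : Fin 3, (Torus.partialDeriv j (fun y => u (s + e) y i) x -
        if i = j then (∑ k : Fin 3, Torus.partialDeriv k (fun y => u (s + e) y k) x) / 3 else 0) *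
      (Mmom r (Φ.flow s z) x i j - momC r (Φ.flow s z) x i * momC r (Φ.flow s z) x j / rhoC r (Φ.flow s z) x)) +
    (∫ s in Icc 0 τ, ∫ x, (∑ k : Fin 3, Torus.partialDeriv k (fun y => u (s + e) y k) x) *
      (rhoC r (Φ.flow s z) x * thetaC r (Φ.flow s z) x -
        rhoC r (Φ.flow s z) x * thetaC r (Φ.flow s z) x * χe (rhoC r (Φ.flow s z) x))) +
    (N + 1 : ℝ)⁻¹ * collisionPairSum (Torus.geometry (Fin 3)) (hsDiameter σ N) (fun s => Φ.flow s z) (Ioc 0 τ)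
      (fun s i j => ∑ k : Fin 3, (∫ x, u (s + e) x k * cone r (Φ.flow s z i).1 x) *
        ((Φ.flow s z i).2 k - (vin (Φ.flow s z) i j).1 k)) := by
  obtain ⟨⟨iG, -, pG, -⟩, hT, ⟨iW, -, pW, -⟩, ⟨iP, -, pP, -⟩⟩ :=
    residual_integrands Φ hz hr hr2 hu he.le hb hbe hχ hB0 hB hCu hut hD
  beta_reduce at iG pG hT iW pW iP pP
  have hsub : Icc 0 τ ⊆ Icc 0 b := Icc_subset_Icc_right hτ.2
  -- the exact momentum identity
  have hW := momentum_identity_shifted hσ hσ2 Φ hz hr hu he hb hbe hτ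
    (fun k => (hT k).2.2.1.mono_set hsub) (fun k s hs => (hT k).1 s (hsub hs))
  -- the transport algebra, pointwise then integrated
  have hpt : ∀ s ∈ Icc 0 τ, ∀ x, (⟪Torus.timeDerivWithin (Ico 0 T) u (s + e) x, momC r (Φ.flow s z) x⟫_ℝ +
      ∑ i : Fin 3, ∑ j : Fin 3, Torus.partialDeriv j (fun y => u (s + e) y i) x * Mmom r (Φ.flow s z) x i j) =
      (⟪Torus.timeDerivWithin (Ico 0 T) u (s + e) x, momC r (Φ.flow s z) x⟫_ℝ +
        ∑ i : Fin 3, ∑ j : Fin 3, Torus.partialDeriv j (fun y => u (s + e) y i) x *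
          (momC r (Φ.flow s z) x i * momC r (Φ.flow s z) x j / rhoC r (Φ.flow s z) x +
            if i = j then rhoC r (Φ.flow s z) x * thetaC r (Φ.flow s z) x * χe (rhoC r (Φ.flow s z) x) else 0)) +
      ((∑ i : Fin 3, ∑ j : Fin 3, (Torus.partialDeriv j (fun y => u (s + e) y i) x -
          if i = j then (∑ k : Fin 3, Torus.partialDeriv k (fun y => u (s + e) y k) x) / 3 else 0) *
        (Mmom r (Φ.flow s z) x i j - momC r (Φ.flow s z) x i * momC r (Φ.flow s z) x j / rhoC r (Φ.flow s z) x)) +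
      (∑ k : Fin 3, Torus.partialDeriv k (fun y => u (s + e) y k) x) *
        (rhoC r (Φ.flow s z) x * thetaC r (Φ.flow s z) x -
          rhoC r (Φ.flow s z) x * thetaC r (Φ.flow s z) x * χe (rhoC r (Φ.flow s z) x))) := by
    intro s _ x
    have h := stub_reductionResidual hr (Φ.flow s z) x (fun i j => Torus.partialDeriv j (fun y => u (s + e) y i) x)
      ⟪Torus.timeDerivWithin (Ico 0 T) u (s + e) x, momC r (Φ.flow s z) x⟫_ℝ
      (rhoC r (Φ.flow s z) x * thetaC r (Φ.flow s z) x * χe (rhoC r (Φ.flow s z) x))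
    linarith [h]
  have hx : ∀ s ∈ Icc 0 τ, (∫ x, (⟪Torus.timeDerivWithin (Ico 0 T) u (s + e) x, momC r (Φ.flow s z) x⟫_ℝ +
      ∑ i : Fin 3, ∑ j : Fin 3, Torus.partialDeriv j (fun y => u (s + e) y i) x * Mmom r (Φ.flow s z) x i j)) =
      (∫ x, (⟪Torus.timeDerivWithin (Ico 0 T) u (s + e) x, momC r (Φ.flow s z) x⟫_ℝ +
        ∑ i : Fin 3, ∑ j : Fin 3, Torus.partialDeriv j (fun y => u (s + e) y i) x *
          (momC r (Φ.flow s z) x i * momC r (Φ.flow s z) x j / rhoC r (Φ.flow s z) x +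
            if i = j then rhoC r (Φ.flow s z) x * thetaC r (Φ.flow s z) x * χe (rhoC r (Φ.flow s z) x) else 0))) +
      ((∫ x, ∑ i : Fin 3, ∑ j : Fin 3, (Torus.partialDeriv j (fun y => u (s + e) y i) x -
          if i = j then (∑ k : Fin 3, Torus.partialDeriv k (fun y => u (s + e) y k) x) / 3 else 0) *
        (Mmom r (Φ.flow s z) x i j - momC r (Φ.flow s z) x i * momC r (Φ.flow s z) x j / rhoC r (Φ.flow s z) x)) +
      (∫ x, (∑ k : Fin 3, Torus.partialDeriv k (fun y => u (s + e) y k) x) *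
        (rhoC r (Φ.flow s z) x * thetaC r (Φ.flow s z) x -
          rhoC r (Φ.flow s z) x * thetaC r (Φ.flow s z) x * χe (rhoC r (Φ.flow s z) x)))) := by
    intro s hs
    have hs' : s ∈ Icc 0 b := hsub hs
    have e1 := integral_add (iG s hs') ((iW s hs').add (iP s hs'))
    have e2 := integral_add (iW s hs') (iP s hs')
    simp only [Pi.add_apply] at e1 e2
    rw [integral_congr_ae (ae_of_all _ fun x => hpt s hs x), e1, e2]
  have hs : (∫ s in Icc 0 τ, ∫ x, (⟪Torus.timeDerivWithin (Ico 0 T) u (s + e) x, momC r (Φ.flow s z) x⟫_ℝ +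
      ∑ i : Fin 3, ∑ j : Fin 3, Torus.partialDeriv j (fun y => u (s + e) y i) x * Mmom r (Φ.flow s z) x i j)) =
      (∫ s in Icc 0 τ, ∫ x, (⟪Torus.timeDerivWithin (Ico 0 T) u (s + e) x, momC r (Φ.flow s z) x⟫_ℝ +
        ∑ i : Fin 3, ∑ j : Fin 3, Torus.partialDeriv j (fun y => u (s + e) y i) x *
          (momC r (Φ.flow s z) x i * momC r (Φ.flow s z) x j / rhoC r (Φ.flow s z) x +
            if i = j then rhoC r (Φ.flow s z) x * thetaC r (Φ.flow s z) x * χe (rhoC r (Φ.flow s z) x) else 0))) +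
      (∫ s in Icc 0 τ, ∫ x, ∑ i : Fin 3, ∑ j : Fin 3, (Torus.partialDeriv j (fun y => u (s + e) y i) x -
          if i = j then (∑ k : Fin 3, Torus.partialDeriv k (fun y => u (s + e) y k) x) / 3 else 0) *
        (Mmom r (Φ.flow s z) x i j - momC r (Φ.flow s z) x i * momC r (Φ.flow s z) x j / rhoC r (Φ.flow s z) x)) +
      (∫ s in Icc 0 τ, ∫ x, (∑ k : Fin 3, Torus.partialDeriv k (fun y => u (s + e) y k) x) *
        (rhoC r (Φ.flow s z) x * thetaC r (Φ.flow s z) x -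
          rhoC r (Φ.flow s z) x * thetaC r (Φ.flow s z) x * χe (rhoC r (Φ.flow s z) x))) := by
    have e1 := integral_add (pG.mono_set hsub) ((pW.mono_set hsub).add (pP.mono_set hsub))
    have e2 := integral_add (μ := volume.restrict (Icc 0 τ)) (pW.mono_set hsub) (pP.mono_set hsub)
    simp only [Pi.add_apply] at e1 e2
    rw [setIntegral_congr_fun measurableSet_Icc hx, e1, e2, add_assoc]
  rw [hs] at hW
  linarith [hW]

end Summit.AtomisticToContinuum.HydrodynamicLimit.Theorems.ChaosClosesEulerReduction

end
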